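import Literature.NumberTheory.Automorphic.NewformAdelisationAutomorphicForm
import Literature.NumberTheory.Automorphic.NewformAutomorphicRepSatake
import Literature.NumberTheory.Automorphic.GL2ArchParameterOfEigenquotient
import Literature.NumberTheory.Automorphic.GL2ZCharacterOfEigenfunction
import Literature.NumberTheory.Automorphic.AutomorphicRepsGLPeterssonAdmissible
import Literature.NumberTheory.Automorphic.ArchimedeanApplyFreeCongr
import Literature.NumberTheory.Automorphic.HarishChandraFinitenessGL
import Literature.NumberTheory.Automorphic.AutomorphicRepsGLCuspidalQuasiSimple
import HarnessLib

/-!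
# The cuspidal automorphic representation of a holomorphic eigenform: Satake parameters away from
# the level and archimedean parameter `{(k-1)/2, (1-k)/2}`

Topic `NumberTheory/Automorphic`; theorems only (no definition, no named fact; D-0026). The
archimedean brick of the dictionary `f ↦ π_f` (Gelbart 1975, §3–4; Gelbart 1997, Prop. 2.5 and
Remark 2.5.5; Bump 1997, §2.2, §3.6; Knapp 2002, Thm. 5.44): for an eigenform `f ∈ S_k(N, χ)`,
`f ≠ 0`, there is a cuspidal automorphic representation `P = W / W'` of `GL₂(𝔸_ℚ)` with
`φ_f ∈ W ∖ W'`, Satake parameters `{α₁, α₂}`, `α₁ + α₂ = a_p p^{(1-k)/2}`, `α₁ α₂ = χ(p)` at the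
places over `p ∤ N`, AND archimedean (Harish-Chandra) parameter `{(k-1)/2, (1-k)/2}` — that of the
discrete series `D_k`:

* `exists_cuspidalAutomorphicRepData_archParameter_satake_of_eigenform`.

Proof. Let `θ₀` be the `Z(𝔤)`-character of `φ_f` (`NewformAdelisationZFinite`,
`Rat.hasZCharacter_of_casimir_of_zed`). The space `V` of cusp forms on `GL₂(𝔸_ℚ)` with
`Z(𝔤)`-character `θ₀` is a `(𝔤, K_∞) × GL₂(𝔸_f)`-stable space of automorphic forms: stability
under `𝔤` and `GL₂(𝔸_f)` because central words commute with Lie derivatives and finite right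
translations (`applyFree_lieDeriv_of_isCentralWord_of_isArchSmooth`,
`applyFree_rightTranslation_of_mem_finiteAdelic`); under `K_∞` because `r(k) ψ` has character
`θ₀ ∘ Ad(k⁻¹)` (`HasZCharacter.archTranslate`) and `θ₀ ∘ Ad(k⁻¹) = θ₀` on central words, as both
are characters of the non-zero function `r(k) φ_f ∈ ℂ φ_f + ℂ r(ε) φ_f`
(`kTranslateSpan_adelicLiftFunA_le`; `r(ε) φ_f` has character `θ₀` by
`Rat.hasZCharacter_of_hasZCharacter_of_casimir_of_zed`, since `r(ε)` preserves the eigen-equations).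
The representation generated by `φ_f` inside `V` (`exists_cuspidalAutomorphicRepData_satake_of_eigenform`)
then has `W ≤ V`, so `C` and `Z` act on `W` by the scalars of `φ_f`
(`Rat.sum_lieDeriv_single_eq_smul_of_hasZCharacter`), and
`AutomorphicRepData.hasArchParameter_of_casimir_of_zed` gives the archimedean parameter.

## References

* S. Gelbart, *Automorphic forms on adele groups* (1975), §3, Prop. 3.1; §4. [Gelbart1975]
* S. Gelbart, *Three lectures …* (1997), Prop. 2.5, Remark 2.5.5. [Gelbart1997]
* D. Bump, *Automorphic Forms and Representations* (1997), §2.2, §3.6. [Bump1997]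
* A. W. Knapp, *Lie Groups Beyond an Introduction* (2002), Thm. 5.44. [Knapp2002]
* A. Borel, H. Jacquet, Corvallis 1979, 4.2–4.6. [BorelJacquet1979]
-/

noncomputable section

open scoped MatrixGroups Matrix Classical
open NumberField NumberField.mixedEmbedding IsDedekindDomain Polynomial

namespace Literature.NumberTheory.Automorphic

-- Mathlib idiom (Mathlib/Algebra/Lie/OfAssociative.lean), as in `GL2WeightVectors`: Lie subalgebras of matrix algebras.
attribute [local instance 100] LieRing.ofAssociativeRing

open GL2Real EllipticCurves.ModularForms CongruenceSubgroup Rat.HeightOneSpectrum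

variable {hcpt : isCompact_glFiniteIntegralLevel 2 ℚ} {N : ℕ} [NeZero N] {k : ℤ}

attribute [local instance] neZero_natGenerator

/-- `ε ⊗ 1 ∈ K_∞`, the maximal compact subgroup of the archimedean group of the datum (`εᵀ ε = 1`). [folklore] -/
private theorem epsK_mem_maximalCompact :
    Rat.realToMixedGL 2 ((epsK : (RealMatrixGroup.gl ℝ (Fin 2)).carrier) : GL (Fin 2) ℝ) ∈
      (AutomorphyDatum.gl 2 ℚ hcpt).arch.maximalCompact :=
  Rat.realToMixedGL_mem_maximalCompact transpose_epsK_mul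

/-- `r(ε) φ` along `ι_𝔸` is right translation by the element `ε ⊗ 1` of `K_∞`. [folklore] -/
private theorem archTranslate_epsK_eq_rightTranslation_ofK (φ : (AdelicGroupData.gl 2 ℚ).Adelic → ℂ) :
    archTranslate Rat.iotaA epsK φ =
      rightTranslation (AdelicGroupData.gl 2 ℚ)
        ((AutomorphyDatum.gl 2 ℚ hcpt).ofK ⟨_, epsK_mem_maximalCompact⟩) φ :=
  Rat.archTranslate_iotaA_eq_rightTranslation_ofK epsK transpose_epsK_mul φ

set_option maxHeartbeats 800000 in
/-- **The `θ`-isotypic cusp forms form a stable space** when `θ` is the `Z(𝔤)`-character of a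
non-zero `(C, Z)`-eigen cusp form `φ` whose `K_∞`-translates lie in `ℂ φ + ℂ r(ε) φ` (e.g. the adelic
lift of a holomorphic cusp form): the space `V = {ψ ∈ 𝒜₀ | ψ has Z(𝔤)-character θ}` is
`(𝔤, K_∞) × GL₂(𝔸_f)`-stable (`applyFree_lieDeriv_of_isCentralWord_of_isArchSmooth`,
`applyFree_rightTranslation_of_mem_finiteAdelic`, `HasZCharacter.archTranslate` with
`θ ∘ Ad(k⁻¹) = θ` on central words, read off on the non-zero translate `r(k) φ ∈ V`).
[cite: BorelJacquet1979, 4.3 (ii) and 4.6] -/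
theorem Rat.exists_isStableSubmodule_hasZCharacter {s₁ s₂ : ℂ}
    {φ : (AdelicGroupData.gl 2 ℚ).Adelic → ℂ} (hφcusp : φ ∈ cuspFormsGL 2 ℚ hcpt) (hφ0 : φ ≠ 0)
    (hC : (∑ a : Fin 2, ∑ b : Fin 2, lieDeriv Rat.iotaA (toLie (Matrix.single a b (1 : ℝ)))
        (lieDeriv Rat.iotaA (toLie (Matrix.single b a (1 : ℝ))) φ)) = (s₁ ^ 2 + s₂ ^ 2 - 1 / 2) • φ)
    (hZ : lieDeriv Rat.iotaA (toLie 1) φ = (s₁ + s₂) • φ)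
    {θ : centerU (AutomorphyDatum.gl 2 ℚ hcpt).arch →ₐ[ℝ] ℂ}
    (hθ : HasZCharacter (AutomorphyDatum.gl 2 ℚ hcpt).ofArch φ θ)
    (hK : kTranslateSpan (AutomorphyDatum.gl 2 ℚ hcpt).ofArch φ ≤
      Submodule.span ℂ {φ, archTranslate Rat.iotaA epsK φ}) :
    ∃ V : Submodule ℂ ((AdelicGroupData.gl 2 ℚ).Adelic → ℂ),
      IsStableSubmodule (AutomorphyDatum.gl 2 ℚ hcpt) V ∧ V ≤ cuspFormsGL 2 ℚ hcpt ∧ φ ∈ V ∧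
      ∀ ψ ∈ V, HasZCharacter (AutomorphyDatum.gl 2 ℚ hcpt).ofArch ψ θ := by
  -- smoothness of cusp forms
  have hsmooth : ∀ ψ ∈ cuspFormsGL 2 ℚ hcpt, IsArchSmooth (AutomorphyDatum.gl 2 ℚ hcpt).ofArch ψ := fun ψ hψ =>
    (mem_archSmooth_iff _ _).1 (automorphicForms_le_archSmooth _ (cuspFormsGL_le_automorphicForms 2 ℚ hcpt hψ))
  have hφs : IsArchSmooth (AutomorphyDatum.gl 2 ℚ hcpt).ofArch φ := hsmooth φ hφcusp
  -- `r(ε) φ` has character `θ` and is a cusp form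
  have hεs : IsArchSmooth (AutomorphyDatum.gl 2 ℚ hcpt).ofArch (archTranslate Rat.iotaA epsK φ) := by
    rw [archTranslate_epsK_eq_rightTranslation_ofK (hcpt := hcpt), ← AutomorphyDatum.archTranslate_ofK]
    exact isArchSmooth_archTranslate _ _ hφs
  have hθε : HasZCharacter (AutomorphyDatum.gl 2 ℚ hcpt).ofArch (archTranslate Rat.iotaA epsK φ) θ :=
    Rat.hasZCharacter_of_hasZCharacter_of_casimir_of_zed hφs hφ0 hC hZ hθ hεs
      (Rat.sum_lieDeriv_single_archTranslate_epsK hC) (Rat.lieDeriv_one_archTranslate_epsK hZ)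
  have hεcusp : archTranslate Rat.iotaA epsK φ ∈ cuspFormsGL 2 ℚ hcpt := by
    rw [archTranslate_epsK_eq_rightTranslation_ofK (hcpt := hcpt)]
    exact (isStableSubmodule_cuspFormsGL (hcpt := hcpt)).k_stable _ hφcusp
  -- the submodule
  refine ⟨{ carrier := {ψ | ψ ∈ cuspFormsGL 2 ℚ hcpt ∧ HasZCharacter (AutomorphyDatum.gl 2 ℚ hcpt).ofArch ψ θ}
            add_mem' := fun {ψ₁ ψ₂} h₁ h₂ => ⟨add_mem h₁.1 h₂.1,
              HasZCharacter.add_gl (hsmooth _ h₁.1) (hsmooth _ h₂.1) h₁.2 h₂.2⟩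
            zero_mem' := ⟨zero_mem _, hasZCharacter_zero_gl θ⟩
            smul_mem' := fun c ψ h => ⟨Submodule.smul_mem _ c h.1, HasZCharacter.smul_gl c h.2⟩ }, ?_, fun ψ hψ => hψ.1,
    ⟨hφcusp, hθ⟩, fun ψ hψ => hψ.2⟩
  -- the two generators lie in it, hence all `K_∞`-translates of `φ`
  have hgen : ∀ (κ : (AutomorphyDatum.gl 2 ℚ hcpt).arch.maximalCompact),
      archTranslate (AutomorphyDatum.gl 2 ℚ hcpt).ofArch
          (Subgroup.inclusion (AutomorphyDatum.gl 2 ℚ hcpt).arch.maximalCompact_le_carrier κ) φ ∈ cuspFormsGL 2 ℚ hcpt ∧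
        HasZCharacter (AutomorphyDatum.gl 2 ℚ hcpt).ofArch
          (archTranslate (AutomorphyDatum.gl 2 ℚ hcpt).ofArch
            (Subgroup.inclusion (AutomorphyDatum.gl 2 ℚ hcpt).arch.maximalCompact_le_carrier κ) φ) θ := by
    intro κ
    have hle : Submodule.span ℂ ({φ, archTranslate Rat.iotaA epsK φ} : Set ((AdelicGroupData.gl 2 ℚ).Adelic → ℂ)) ≤
        { carrier := {ψ | ψ ∈ cuspFormsGL 2 ℚ hcpt ∧ HasZCharacter (AutomorphyDatum.gl 2 ℚ hcpt).ofArch ψ θ}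
          add_mem' := fun {ψ₁ ψ₂} h₁ h₂ => ⟨add_mem h₁.1 h₂.1,
            HasZCharacter.add_gl (hsmooth _ h₁.1) (hsmooth _ h₂.1) h₁.2 h₂.2⟩
          zero_mem' := ⟨zero_mem _, hasZCharacter_zero_gl θ⟩
          smul_mem' := fun c ψ h => ⟨Submodule.smul_mem _ c h.1, HasZCharacter.smul_gl c h.2⟩ } := by
      rw [Submodule.span_le]
      intro ψ hψ
      rcases hψ with rfl | hψ
      · exact ⟨hφcusp, hθ⟩
      · rw [Set.mem_singleton_iff.1 hψ]; exact ⟨hεcusp, hθε⟩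
    exact hle (hK (archTranslate_mem_kTranslateSpan _ κ φ))
  -- `θ ∘ Ad(k⁻¹) = θ` on central words
  have hKθ : ∀ (κ : (AutomorphyDatum.gl 2 ℚ hcpt).arch.maximalCompact)
      (p : FreeAlgebra ℝ (AutomorphyDatum.gl 2 ℚ hcpt).arch.lie) (hp : IsCentralWord p),
      (θ.comp (adCenterInv (AutomorphyDatum.gl 2 ℚ hcpt).arch
        (Subgroup.inclusion (AutomorphyDatum.gl 2 ℚ hcpt).arch.maximalCompact_le_carrier κ)))
        ⟨freeToEnveloping (AutomorphyDatum.gl 2 ℚ hcpt).arch p, hp⟩ =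
      θ ⟨freeToEnveloping (AutomorphyDatum.gl 2 ℚ hcpt).arch p, hp⟩ := by
    intro κ p hp
    have h1 := HasZCharacter.archTranslate (AutomorphyDatum.gl 2 ℚ hcpt).ofArch hθ
      (Subgroup.inclusion (AutomorphyDatum.gl 2 ℚ hcpt).arch.maximalCompact_le_carrier κ)
    obtain ⟨-, h2⟩ := hgen κ
    have h3 : archTranslate (AutomorphyDatum.gl 2 ℚ hcpt).ofArch
        (Subgroup.inclusion (AutomorphyDatum.gl 2 ℚ hcpt).arch.maximalCompact_le_carrier κ) φ ≠ 0 := by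
      intro h0
      apply hφ0
      have e : φ = rightTranslation (AdelicGroupData.gl 2 ℚ) ((AutomorphyDatum.gl 2 ℚ hcpt).ofK κ)⁻¹
          (archTranslate (AutomorphyDatum.gl 2 ℚ hcpt).ofArch
            (Subgroup.inclusion (AutomorphyDatum.gl 2 ℚ hcpt).arch.maximalCompact_le_carrier κ) φ) := by
        rw [AutomorphyDatum.archTranslate_ofK, ← Module.End.mul_apply, ← map_mul, inv_mul_cancel, map_one,
          Module.End.one_apply]
      rw [e, h0, map_zero]
    have h4 := h1 p hp
    rw [h2 p hp] at h4
    exact (smul_left_injective ℂ h3 h4).symm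
  -- stability
  exact
    { le_automorphicForms := fun ψ hψ => cuspFormsGL_le_automorphicForms 2 ℚ hcpt hψ.1
      finite_stable := fun h hh ψ hψ => ⟨(isStableSubmodule_cuspFormsGL (hcpt := hcpt)).finite_stable h hh hψ.1,
        fun p hp => by
          rw [applyFree_rightTranslation_of_mem_finiteAdelic p hh, hψ.2 p hp, map_smul]⟩
      k_stable := fun κ ψ hψ => ⟨(isStableSubmodule_cuspFormsGL (hcpt := hcpt)).k_stable κ hψ.1, fun p hp => by
          rw [← AutomorphyDatum.archTranslate_ofK,
            (HasZCharacter.archTranslate (AutomorphyDatum.gl 2 ℚ hcpt).ofArch hψ.2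
              (Subgroup.inclusion (AutomorphyDatum.gl 2 ℚ hcpt).arch.maximalCompact_le_carrier κ)) p hp, hKθ κ p hp]⟩
      lie_stable := fun X ψ hψ => ⟨(isStableSubmodule_cuspFormsGL (hcpt := hcpt)).lie_stable X ψ hψ.1,
        fun p hp => by
          rw [applyFree_lieDeriv_of_isCentralWord_of_isArchSmooth hp X (hsmooth ψ hψ.1), hψ.2 p hp,
            lieDeriv_smul]⟩ }

/-- **The cuspidal automorphic representation of a holomorphic eigenform, with its Satake and
archimedean parameters.** Let `f ∈ S_k(N, χ)`, `f ≠ 0`, with `T_p f = a_p f` for the primes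
`p ∤ N`. There is a cuspidal automorphic representation `P = W / W'` of `GL₂(𝔸_ℚ)` with
`φ_f ∈ W ∖ W'` which has archimedean parameter `{(k-1)/2, (1-k)/2}` (the Harish-Chandra parameter
of the discrete series `D_k`; Knapp 2002, Thm. 5.44; Gelbart 1997, Remark 2.5.5) and, at every
finite place `v` over `p ∤ N`, a Satake parameter `α` with
`∏_{a ∈ α}(X - a) = X² - a_p p^{(1-k)/2} X + χ(p)` (Gelbart 1997, (2.5.1)).
[cite: Gelbart1997, Prop. 2.5 and Remark 2.5.5] [cite: Knapp2002, Thm. 5.44] [cite: Gelbart1975, §3–4]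
[cite: BorelJacquet1979, 4.6] -/
theorem exists_cuspidalAutomorphicRepData_archParameter_satake_of_eigenform
    (f : CuspForm (Gamma1 N) k) (hf0 : f ≠ 0) (χ : DirichletCharacter ℂ N) (hfχ : f ∈ nebentypusSubspace N k χ)
    (a : ℕ → ℂ)
    (hT : ∀ (p : ℕ) (hp : p.Prime), ¬ p ∣ N →
      (haveI : NeZero p := ⟨hp.ne_zero⟩; EllipticCurves.ModularForms.heckeT (Gamma1 N) k p f) = a p • f) :
    ∃ P : CuspidalAutomorphicRepData 2 ℚ hcpt, adelicLiftFunA N k f ∈ P.1.W ∧ adelicLiftFunA N k f ∉ P.1.W' ∧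
      P.1.HasArchParameter (fun _ => ({(((k : ℤ) : ℂ) - 1) / 2, (1 - ((k : ℤ) : ℂ)) / 2} : Multiset ℂ)) ∧
      ∀ v : HeightOneSpectrum (𝓞 ℚ), ¬ ((primesEquiv v : Nat.Primes) : ℕ) ∣ N →
        ∃ α : Multiset ℂ, P.1.HasSatakeParamAt v α ∧
          satakePolynomial α =
            X ^ 2 - C (a ((primesEquiv v : Nat.Primes) : ℕ) *
              (((Real.sqrt ((primesEquiv v : Nat.Primes) : ℕ) : ℝ) : ℂ) ^ (1 - k))) * X +
              C (χ ((((primesEquiv v : Nat.Primes) : ℕ) : ℕ) : ZMod N)) := by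
  -- the eigen-equations of `φ_f`
  have hCφ : (∑ a : Fin 2, ∑ b : Fin 2, lieDeriv Rat.iotaA (toLie (Matrix.single a b (1 : ℝ)))
      (lieDeriv Rat.iotaA (toLie (Matrix.single b a (1 : ℝ))) (adelicLiftFunA N k f))) =
        (((((k : ℤ) : ℂ) - 1) / 2) ^ 2 + ((1 - ((k : ℤ) : ℂ)) / 2) ^ 2 - 1 / 2) • adelicLiftFunA N k f :=
    sum_lieDeriv_single_adelicLiftFunA' f
  have hZφ : lieDeriv Rat.iotaA (toLie 1) (adelicLiftFunA N k f) =
      ((((k : ℤ) : ℂ) - 1) / 2 + (1 - ((k : ℤ) : ℂ)) / 2) • adelicLiftFunA N k f := by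
    rw [lieDeriv_one_adelicLiftFunA, show (((k : ℤ) : ℂ) - 1) / 2 + (1 - ((k : ℤ) : ℂ)) / 2 = 0 by ring, zero_smul]
  have hφ0 : adelicLiftFunA N k f ≠ 0 := adelicLiftFunA_ne_zero hf0
  have hφcusp : adelicLiftFunA N k f ∈ cuspFormsGL 2 ℚ hcpt := adelicLiftFunA_mem_cuspFormsGL f hcpt
  obtain ⟨θ₀, hθ₀⟩ := Rat.hasZCharacter_of_casimir_of_zed (isArchSmooth_ofArch_adelicLiftFunA_cuspForm f) hCφ hZφ
  obtain ⟨V, hV, hVc, hφV, hVθ⟩ := Rat.exists_isStableSubmodule_hasZCharacter hφcusp hφ0 hCφ hZφ hθ₀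
    (kTranslateSpan_adelicLiftFunA_le (hcpt := hcpt) f)
  -- the representation generated by `φ_f` in `V`
  obtain ⟨P, hφW, hφW', hle, hsat⟩ :=
    exists_cuspidalAutomorphicRepData_satake_of_eigenform hV hVc f hf0 hφV χ hfχ a hT
  refine ⟨P, hφW, hφW', ?_, hsat⟩
  refine P.1.hasArchParameter_of_casimir_of_zed (fun ψ hψ => ?_) (fun ψ hψ => ?_)
  · rw [Rat.sum_lieDeriv_single_eq_smul_of_hasZCharacter hφ0 hCφ hθ₀ (hVθ ψ (hle hψ)), sub_self]
    exact zero_mem _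
  · rw [Rat.lieDeriv_one_eq_smul_of_hasZCharacter hφ0 hZφ hθ₀ (hVθ ψ (hle hψ)), sub_self]
    exact zero_mem _

end Literature.NumberTheory.Automorphic
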